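import Summits.BirchSwinnertonDyer.Rank1Residual.WAll.Target
import Summits.BirchSwinnertonDyer.BirchSwinnertonDyer.Theorems.Rank1ResidualX9Defs
import Literature.NumberTheory.EllipticCurves.JetchevSkinnerWan2017.RankOnePPart
import Literature.NumberTheory.EllipticCurves.Rank1Residual.ClassX1KellerYinCertificate
import Literature.NumberTheory.EllipticCurves.Rank1Residual.Dedup
import Literature.NumberTheory.EllipticCurves.RegulatorProofs
import HarnessLib

/-!
# The W-ALL/9 corner implies the K6 leaf: `WAllCornerX9 → Rank1Residual.BSDpOnClassX9`, the
# semistable rank-one X9 pairs being Jetchev–Skinner–Wan 2017 Thm. 1.2.1 BY NAME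

Cell `pub/bsd-print-x9` (D-0131 (2) print tier), seat `bsd-print-x9-p1`; the bridge ordered by
director-bsd (HOME/INBOX 2026-08-27T13:52:17Z, currency word) and specified by the cell referee
(REF-18 / 13:55:58Z recipe), so that a closure of route `PrintX9`'s target `WAllCornerX9` BY NAME
also yields the charter's leaf `Rank1Residual.BSDpOnClassX9` BY NAME. THEOREMS ONLY; nothing booked.

The two class predicates differ by one clause: the W-ALL/9 corner
(`Summit.BirchSwinnertonDyer.WAllCornerX9`, `WAll/Target.lean`) quantifies over the CENSUS class
`Literature…Rank1Residual.ClassX9` (non-CM, good ordinary `p ≥ 5`, `E[p]` irreducible, `ρ̄` not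
surjective, AND `r = 1 → ¬semistable`), the K6 leaf (`Rank1ResidualX9Defs.BSDpOnClassX9`) over the
Summits-side `ClassX9` without the semistability clause. The gap — the SEMISTABLE X9 pairs of
analytic rank `1` — is covered in print by Jetchev–Skinner–Wan 2017 Thm. 1.2.1 (tree fact
`JetchevSkinnerWan2017.thm121_padicValRat_bsd_rank_one`: semistable, `p ≥ 3` good — the `p = 3`
proviso is vacuous at `p ≥ 5` —, `E[p]` irreducible, `r_an = 1`, `Ш` finite; NO surjectivity),
whose conclusion is the print shape `PPartBSD` up to clearing the denominator `Reg(E) · Ω_E ≠ 0`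
(`regulator_pos'`, `realPeriodRat_pos_holds`). (By Serre 1972 Prop. 21 a semistable curve with
irreducible `E[p]`, `p ≥ 5`, has surjective `ρ̄`, so this locus is in fact empty — the tree's
`ClassX9.not_isSemistable` —, but the bridge does not need that.) On the other pairs the corner
gives Miller's `BSDp`, converted to `PPartBSD` by `Rank1Residual.pPart_of_bsdp` (GZK + entire
continuation) and `pPartBSD_iff_pPart`.

* `bsdpOnClassX9_of_wallCornerX9 (hmod) (hGZK) (hJSW) (h : WAllCornerX9) : Rank1Residual.BSDpOnClassX9`.
Converse: `Summit.BirchSwinnertonDyer.wallCornerX9_of_bsdpOnClassX9` (`WAll/AltClosersGlue.lean`).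
Currency: the JSW row is PUB (flags of the census registry row A4/A5 travel with `hJSW` where the
tree applies them); nothing else enters.

References: [JetchevSkinnerWan2017] Camb. J. Math. 5 (2017), Thm. 1.2.1; [Miller2011LMS] Def. 1.1;
[GrossZagier1986], [KolyvaginEulerSystems1990] (GZK, `hGZK`).
-/

set_option linter.dupNamespace false

set_option autoImplicit false

noncomputable section

open scoped Classical

open WeierstrassCurve NumberField Literature.NumberTheory.EllipticCurves
  Literature.NumberTheory.EllipticCurves.Rank1Residual
  Literature.NumberTheory.EllipticCurves.JetchevSkinnerWan2017

namespace Summit.BirchSwinnertonDyer.BirchSwinnertonDyer.Rank1Residual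

/-- **Corner W-ALL/9 ⟹ the K6 leaf.** `WAllCornerX9` (BSD(E,p) on the census class X9 in analytic
rank `≤ 1`) together with Jetchev–Skinner–Wan 2017 Thm. 1.2.1 BY NAME (`hJSW`, for the semistable
rank-one X9 pairs the census class excludes), the entire continuation of `L(E,s)` (`hmod`) and
Gross–Zagier–Kolyvagin (`hGZK`) gives `Rank1Residual.BSDpOnClassX9` (the `p`-part in print shape on
the Summits-side class X9, no semistability clause). Case split on `r_an = 1 ∧ semistable`.
[cite: JetchevSkinnerWan2017, Thm. 1.2.1] [cite: Miller2011LMS, §1 and Def. 1.1] -/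
theorem bsdpOnClassX9_of_wallCornerX9 (hmod : hasEntireLFunction_rat)
    (hGZK : rank_eq_analyticRank_of_analyticRank_le_one)
    (hJSW : thm121_padicValRat_bsd_rank_one)
    (h : Summit.BirchSwinnertonDyer.WAllCornerX9) : BSDpOnClassX9 := by
  intro W _ _ p _ hr hX hfin
  obtain ⟨hcm, hp, hgood, hord, hirr, hns⟩ := id hX
  by_cases hs : W.analyticRank = 1 ∧ Semistable W
  · -- semistable, analytic rank 1: Jetchev–Skinner–Wan 2017 Thm. 1.2.1 by name
    obtain ⟨q, hq, hv⟩ := hJSW W p (by omega)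
      ((semistable_iff_isSemistable_ringOfIntegers W).mp hs.2) hgood (fun h3 => by omega) hirr hs.1
      hfin
    refine ⟨q, ?_, hv⟩
    have hReg : (W.regulator : ℂ) ≠ 0 := by exact_mod_cast (regulator_ne_zero (W := W))
    have hΩ : (W.realPeriodRat : ℂ) ≠ 0 := by exact_mod_cast W.realPeriodRat_pos_holds.ne'
    rw [div_eq_iff (mul_ne_zero hReg hΩ), hq]
    push_cast
    ring
  · -- otherwise `(W, p)` lies in the census class X9 and the corner gives Miller's `BSD(E,p)`
    have hX' : Literature.NumberTheory.EllipticCurves.Rank1Residual.ClassX9 W p :=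
      ⟨hcm, ⟨hgood, hord⟩, hp, hirr, hns, fun h1 hsst => hs ⟨h1, hsst⟩⟩
    exact (pPartBSD_iff_pPart W p).mpr (pPart_of_bsdp hmod hGZK W p hr (h W p hX' hr))

end Summit.BirchSwinnertonDyer.BirchSwinnertonDyer.Rank1Residual

end
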